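import Summits.BirchSwinnertonDyer.BirchSwinnertonDyer.Theorems.GenusKolyvaginAtTwoGenusPrimitiveSupplyAtTwoMultiGenusField
import Summits.BirchSwinnertonDyer.BirchSwinnertonDyer.Theorems.GenusKolyvaginAtTwoGenusPrimitiveSupplyAtTwoGenusField

/-!
# Route `GenusKolyvaginAtTwo`, crux `GenusPrimitiveSupplyAtTwo` (stmt-BirchSwinnertonDyer-22136), line `genus-supply`:
# the multi-genus trace may be halved INSIDE the multi-genus field — `P(n) ∈ 2E(K[n]) ⟺ Y_n ∈ 2·E(K[n])^{Gal(K[n]/F_n)}`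

Lead prover seat bsd-line-gk2-p1 (g2). Computational form of the composite-level dictionary
(`heegner_exists_two_zsmul_eq_derivedPoint_iff_multiGenusTrace`: `P(n) ∈ 2E(K[n]) ⟺ Y_n := Σ_{g∈T} g·y(n) ∈ 2E(K[n])`,
`T = Gal(K[n]/F_n)`, `F_n = K(√ℓ₁*,…,√ℓ_r*)` the multi-genus field). Since `T` is a GROUP, `Y_n` is `T`-invariant — a point over
`F_n`, a multi-quadratic field of degree `2^{r+1}`, instead of `K[n]` of degree `2 h_K ∏(ℓ+1)` — and since `E(K[n])[2] = 0` on the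
crux's frames (Gross's Lemma 4.3 at `2`: `ρ̄_{E,2}` onto, odd `d_K`, Heegner; tree `heegner_two_torsion_free` from cell
bsd-uniform's U2 track), a halving `2Q = Y_n` in `E(K[n])` forces `Q` itself to be `T`-invariant:
  `P(n) ∈ 2E(K[n]) ⟺ ∃ Q, (∀ g ∈ T, g Q = Q) ∧ 2Q = Y_n`   (`heegner_exists_two_zsmul_eq_derivedPoint_iff_fixed_half`),
i.e. Kolyvagin `2`-primitivity at level `n` is decided inside `E(F_n)` (`2`-saturation of one point over a multi-quadratic
field — the shape of the data ask D-gk2-C). Helper (`--supports stmt-BirchSwinnertonDyer-22136`). No summit and no leaf is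
proved by this file; BSD is not proved by any of this.
-/

set_option linter.dupNamespace false -- tree convention: `Summit.BirchSwinnertonDyer.BirchSwinnertonDyer.Theorems` (summit = sub-problem)

noncomputable section

open scoped Classical

namespace Summit.BirchSwinnertonDyer.BirchSwinnertonDyer.Theorems.GenusKoly

open Finset NumberField WeierstrassCurve Literature.NumberTheory.EllipticCurves
  Literature.NumberTheory.EllipticCurves.ModularForms

section Heegner

variable {W : WeierstrassCurve ℚ} [NeZero (W.conductorNorm ℤ)] {K : Type} [Field K] [NumberField K]
  {Dt : ModularParametrizationData W (W.conductorNorm ℤ)} {β : ℤ} {ι : K →+* ℂ}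

/-- **The multi-genus stabiliser `T = {g ∈ Gal(K[n]/K) : g θ_ℓ = θ_ℓ ∀ ℓ}` is closed under multiplication.** [folklore] -/
theorem heegner_mul_mem_multiGenusStabiliser {n : ℕ} {θ : ℕ → ringClassField K ι n}
    (T : Finset (ringClassField K ι n ≃ₐ[ℚ] ringClassField K ι n))
    (hT : ∀ g, g ∈ T ↔ g ∈ ringClassGal ι n ∧ ∀ ℓ ∈ n.primeFactors, g (θ ℓ) = θ ℓ)
    {g h : ringClassField K ι n ≃ₐ[ℚ] ringClassField K ι n} (hg : g ∈ T) (hh : h ∈ T) : g * h ∈ T := by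
  rw [hT] at hg hh ⊢
  exact ⟨Subgroup.mul_mem _ hg.1 hh.1, fun ℓ hℓ ↦ by rw [AlgEquiv.mul_apply, hh.2 ℓ hℓ, hg.2 ℓ hℓ]⟩

/-- **The multi-genus trace `Y_n = Σ_{g∈T} g·y(n)` is `T`-invariant** (left multiplication by `t ∈ T` permutes `T`).
[folklore] -/
theorem heegner_multiGenusTrace_fixed {n : ℕ} (d : KolyvaginHeegnerData Dt β ι n) {θ : ℕ → ringClassField K ι n}
    (T : Finset (ringClassField K ι n ≃ₐ[ℚ] ringClassField K ι n))
    (hT : ∀ g, g ∈ T ↔ g ∈ ringClassGal ι n ∧ ∀ ℓ ∈ n.primeFactors, g (θ ℓ) = θ ℓ)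
    {t : ringClassField K ι n ≃ₐ[ℚ] ringClassField K ι n} (ht : t ∈ T) :
    pointGalHom W (ringClassField K ι n) t (∑ g ∈ T, pointGalHom W (ringClassField K ι n) g d.y) =
      ∑ g ∈ T, pointGalHom W (ringClassField K ι n) g d.y := by
  rw [map_sum]
  have hre : ∀ g ∈ T, pointGalHom W (ringClassField K ι n) t (pointGalHom W (ringClassField K ι n) g d.y) =
      pointGalHom W (ringClassField K ι n) (t * g) d.y := fun g _ ↦ by rw [map_mul]; rfl
  rw [Finset.sum_congr rfl hre]
  -- reindex along the bijection `g ↦ t * g` of `T`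
  refine Finset.sum_nbij (fun g ↦ t * g) (fun g hg ↦ heegner_mul_mem_multiGenusStabiliser T hT ht hg) ?_ ?_ (fun _ _ ↦ rfl)
  · intro g _ g' _ hgg'
    exact mul_left_cancel hgg'
  · intro g hg
    have htinv : t⁻¹ ∈ T := by
      rw [hT] at ht ⊢
      refine ⟨Subgroup.inv_mem _ ht.1, fun ℓ hℓ ↦ ?_⟩
      have h := ht.2 ℓ hℓ
      conv_lhs => rw [← h]
      exact t.symm_apply_apply (θ ℓ)
    exact ⟨t⁻¹ * g, Finset.mem_coe.mpr (heegner_mul_mem_multiGenusStabiliser T hT htinv (Finset.mem_coe.mp hg)),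
      by simp only; rw [mul_inv_cancel_left]⟩

/-- **`P(n) ∈ 2E(K[n]) ⟺ Y_n` is twice a `T`-INVARIANT point** (a point over the multi-genus field `F_n = K(√ℓ* : ℓ ∣ n)`):
for `W` globally minimal with `ρ̄_{E,2}` onto, `K` imaginary quadratic with odd `d_K ≠ −3` and the Heegner hypothesis, `n`
square-free of Kolyvagin primes at `2`, any square roots `θ_ℓ = √ℓ*` and any finite `T` enumerating `Gal(K[n]/F_n)`. (⟸) is
trivial; (⟹): `E(K[n])[2] = 0` (`heegner_two_torsion_free`) and `Y_n` is `T`-invariant, so `2(gQ − Q) = 0` forces `gQ = Q`.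
Reduces the `2`-divisibility test of Kolyvagin's `P(n)` from `E(K[n])` to `E(F_n)`, `[F_n : ℚ] = 2^{r+1}`.
[cite: GrossLMS1991, §4 Lemma 4.3, (4.1)] [cite: Cox2013, Thm. 9.18, §9.A] -/
theorem heegner_exists_two_zsmul_eq_derivedPoint_iff_fixed_half [W.IsElliptic] [W.IsGloballyMinimal]
    (hK : IsImaginaryQuadratic K) (hodd : Odd (NumberField.discr K)) (h3 : NumberField.discr K ≠ -3)
    (hH : SatisfiesHeegnerHypothesis (W.conductorNorm ℤ) K) (hsurj : W.HasSurjectiveModNGaloisRep ((2 : ℤ) ^ 1))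
    {n : ℕ} (hn : Squarefree n) (hKoly : ∀ ℓ ∈ n.primeFactors, Zhang2014.IsKolyvaginPrime (W.conductorNorm ℤ) W K 2 ℓ)
    (d : KolyvaginHeegnerData Dt β ι n) {θ : ℕ → ringClassField K ι n}
    (hθ : ∀ ℓ ∈ n.primeFactors, θ ℓ ^ 2 = algebraMap ℚ (ringClassField K ι n) ((-1 : ℚ) ^ (ℓ / 2) * ℓ))
    (T : Finset (ringClassField K ι n ≃ₐ[ℚ] ringClassField K ι n))
    (hT : ∀ g, g ∈ T ↔ g ∈ ringClassGal ι n ∧ ∀ ℓ ∈ n.primeFactors, g (θ ℓ) = θ ℓ) :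
    (∃ Q : (W.baseChange (ringClassField K ι n)).toAffine.Point, (2 : ℤ) • Q = d.derivedPoint) ↔
      ∃ Q : (W.baseChange (ringClassField K ι n)).toAffine.Point,
        (∀ g ∈ T, pointGalHom W (ringClassField K ι n) g Q = Q) ∧
        (2 : ℤ) • Q = ∑ g ∈ T, pointGalHom W (ringClassField K ι n) g d.y := by
  rw [heegner_exists_two_zsmul_eq_derivedPoint_iff_multiGenusTrace hK (discr_lt_neg_four_of_odd hK hodd h3) hH hn hKoly d
    hθ T hT]
  constructor
  · rintro ⟨Q, hQ⟩
    refine ⟨Q, fun g hg ↦ ?_, hQ⟩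
    have h2 : (2 : ℤ) • (pointGalHom W (ringClassField K ι n) g Q - Q) = 0 := by
      rw [smul_sub, ← map_zsmul, hQ, heegner_multiGenusTrace_fixed d T hT hg, sub_self]
    exact sub_eq_zero.mp (heegner_two_torsion_free (ι := ι) hK hodd hH hsurj hn.ne_zero _ h2)
  · rintro ⟨Q, -, hQ⟩
    exact ⟨Q, hQ⟩

/-! ### §2 (APPEND 1, same seat) The stabiliser `T` is CANONICAL: independent of the chosen square roots; `(θ, T)` exist -/

/-- **`T` does not depend on the choice of square roots**: if `θ_ℓ² = θ'_ℓ² = ℓ*` for all `ℓ ∣ n` then an automorphism fixes every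
`θ_ℓ` iff it fixes every `θ'_ℓ` (`θ'_ℓ = ±θ_ℓ`), so the two stabilisers — hence the two multi-genus traces — coincide. For the
planner's typing of the open kernel U: «∃ θ T …» and «∀ θ T …» are interchangeable. [cite: Cox2013, Thm. 9.18, §9.A] -/
theorem heegner_multiGenusStabiliser_eq_of_sq_eq {n : ℕ} {θ θ' : ℕ → ringClassField K ι n}
    (hθ : ∀ ℓ ∈ n.primeFactors, θ ℓ ^ 2 = algebraMap ℚ (ringClassField K ι n) ((-1 : ℚ) ^ (ℓ / 2) * ℓ))
    (hθ' : ∀ ℓ ∈ n.primeFactors, θ' ℓ ^ 2 = algebraMap ℚ (ringClassField K ι n) ((-1 : ℚ) ^ (ℓ / 2) * ℓ))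
    (T T' : Finset (ringClassField K ι n ≃ₐ[ℚ] ringClassField K ι n))
    (hT : ∀ g, g ∈ T ↔ g ∈ ringClassGal ι n ∧ ∀ ℓ ∈ n.primeFactors, g (θ ℓ) = θ ℓ)
    (hT' : ∀ g, g ∈ T' ↔ g ∈ ringClassGal ι n ∧ ∀ ℓ ∈ n.primeFactors, g (θ' ℓ) = θ' ℓ) : T = T' := by
  have hpm : ∀ ℓ ∈ n.primeFactors, θ' ℓ = θ ℓ ∨ θ' ℓ = -θ ℓ := fun ℓ hℓ ↦
    eq_or_eq_neg_of_sq_eq_sq _ _ (by rw [hθ' ℓ hℓ, hθ ℓ hℓ])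
  have key : ∀ (g : ringClassField K ι n ≃ₐ[ℚ] ringClassField K ι n), ∀ ℓ ∈ n.primeFactors,
      (g (θ ℓ) = θ ℓ ↔ g (θ' ℓ) = θ' ℓ) := by
    intro g ℓ hℓ
    rcases hpm ℓ hℓ with h | h
    · rw [h]
    · rw [h, map_neg, neg_inj]
  ext g
  rw [hT, hT']
  exact and_congr_right fun _ ↦ forall₂_congr fun ℓ hℓ ↦ key g ℓ hℓ

/-- **The multi-genus datum `(θ, T)` exists** at every square-free level of Kolyvagin primes at `2`: square roots `θ_ℓ = √ℓ* ∈ K[n]`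
(`heegner_exists_multiGenusRadicals`) and a finite `T` enumerating `Gal(K[n]/K(θ_ℓ : ℓ ∣ n))`, realised as the `θ`-fixed
elements of `S · SPAN = Gal(K[n]/K)`. [cite: Cox2013, Thm. 9.18, §9.A] [cite: GrossLMS1991, §3–§4 (S, G_n ≃ ∏ G_ℓ)] -/
theorem heegner_exists_multiGenusDatum [W.IsGloballyMinimal] (hK : IsImaginaryQuadratic K) (hD : NumberField.discr K < -4)
    {n : ℕ} (hn : Squarefree n) (hKoly : ∀ ℓ ∈ n.primeFactors, Zhang2014.IsKolyvaginPrime (W.conductorNorm ℤ) W K 2 ℓ)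
    (d : KolyvaginHeegnerData Dt β ι n) :
    ∃ (θ : ℕ → ringClassField K ι n) (T : Finset (ringClassField K ι n ≃ₐ[ℚ] ringClassField K ι n)),
      (∀ ℓ ∈ n.primeFactors, θ ℓ ^ 2 = algebraMap ℚ (ringClassField K ι n) ((-1 : ℚ) ^ (ℓ / 2) * ℓ)) ∧
      ∀ g, g ∈ T ↔ g ∈ ringClassGal ι n ∧ ∀ ℓ ∈ n.primeFactors, g (θ ℓ) = θ ℓ := by
  have hinert : ∀ q ∈ n.primeFactors, (Ideal.span {(q : 𝓞 K)}).IsPrime := fun q hq ↦ (hKoly q hq).2.2.2.2.1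
  obtain ⟨θ, hθ⟩ := heegner_exists_multiGenusRadicals hK hn hKoly d
  refine ⟨θ, ((d.S ×ˢ n.primeFactorsList.foldr (fun ℓ T ↦ (range (ℓ + 1) ×ˢ T).image (fun p ↦ d.σ ℓ ^ p.1 * p.2))
      ({1} : Finset (ringClassField K ι n ≃ₐ[ℚ] ringClassField K ι n))).image
      (fun p : (ringClassField K ι n ≃ₐ[ℚ] ringClassField K ι n) ×
        (ringClassField K ι n ≃ₐ[ℚ] ringClassField K ι n) ↦ p.1 * p.2)).filter
      (fun g ↦ ∀ ℓ ∈ n.primeFactors, g (θ ℓ) = θ ℓ), hθ, fun g ↦ ?_⟩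
  rw [Finset.mem_filter, Finset.mem_image, heegner_mem_ringClassGal_iff_exists_mul_span hK hD hn hinert d g]
  constructor
  · rintro ⟨⟨⟨s, t⟩, hst, rfl⟩, hfix⟩
    exact ⟨⟨s, (Finset.mem_product.mp hst).1, t, (Finset.mem_product.mp hst).2, rfl⟩, hfix⟩
  · rintro ⟨⟨s, hs, t, ht, rfl⟩, hfix⟩
    exact ⟨⟨⟨s, t⟩, Finset.mem_product.mpr ⟨hs, ht⟩, rfl⟩, hfix⟩

end Heegner

end Summit.BirchSwinnertonDyer.BirchSwinnertonDyer.Theorems.GenusKoly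

end
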